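/-
Copyright (c) 2026 H21 harness. All rights reserved.
Released under Apache 2.0 license as described in the file LICENSE.
-/
import Mathlib

/-!
# Frobenius-closing steer — K-β6 `SqModSqDescent`: square classes descend from the completion

Context: Steer crux `stmt-ResolutionOfSingularities-16345`, hK4′ β-leaf (RULINGs 143 / 148c / 150(4); words res-L0-w41-strat-2
`Sketch-beta-v18-hatleaf.lean` §5♯).  Termination of the β-block in the completion `Ŝ` produces a CLEANER `q̂ ∈ Ŝ` with
`f + q̂² ∈ 𝔭² Ŝ`, while the legality statements need a cleaner `q ∈ S`.  This file proves the descent, for ANY ideal `I` of `S`: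

* `sq_add_mem_of_hat` — `S` a Noetherian local ring of characteristic `2` which is F-FINITE (`S` is a finite module over its subring of
  squares `(frobenius S 2).range`), `ι : S →+* T` into a local ring `T` with `𝔪_S T = 𝔪_T`, `ι(S)` dense (`∀ n t, ∃ a, t − ι a ∈ 𝔪_T ^ n`) and
  `𝔪_T ^ n ∩ S = 𝔪_S ^ n` (the three clauses of strat-2's `IsHatOf` that pin `T / 𝔪_T^n ≅ S / 𝔪^n`), `I` an ideal of `S`, `f ∈ S`:
  `(∃ q̂ : T, ι f + q̂ ^ 2 ∈ I.map ι) → ∃ q : S, f + q ^ 2 ∈ I`.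

No regularity, no regular system of parameters and no excellence is used; F-finiteness replaces excellence (it implies it, by Kunz, and it
holds for the run's members, localisations of finitely generated algebras over a perfect field; tri-1's non-excellent DVR `k⟦y⟧ ∩ k(y, v²)` is
not F-finite and is correctly excluded).

Proof (Frobenius-twisted Krull intersection, no `p`-basis):
* `mem_of_map_mem` — CONTRACTION for `𝔪`-primary ideals: if `𝔪 ^ N ≤ J` and `ι a ∈ J.map ι` then `a ∈ J` (density + the third clause);
* `sq_mem_map_sqIdeal` — for `e ∈ 𝔪_T ^ n = (𝔪 ^ n).map ι`, `e ^ 2 ∈ (sqIdeal n).map ι` where `sqIdeal n = span {m ^ 2 | m ∈ 𝔪 ^ n}`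
  (squares are additive in characteristic `2`); `exists_pow_le_sqIdeal` — `sqIdeal n` is `𝔪`-primary;
* `exists_sq_add_mem_sup` — APPROXIMATION: `q̂ = ι a + e` with `e ∈ 𝔪_T ^ n` gives `ι (f + a ^ 2) = (ι f + q̂ ^ 2) + e ^ 2`, hence
  `f + a ^ 2 ∈ I ⊔ sqIdeal n` for every `n`;
* `sq_add_mem_of_forall` — KRULL: over the Noetherian local ring `A = S²` the finite module `S` has the submodule `N = A·1 + I`;
  `sqIdeal n ≤ 𝔫 ^ n • S` (`𝔫 = 𝔪_A ∋ m²` for `m ∈ 𝔪`), so the class of `f` lies in `⨅ₙ 𝔫 ^ n • (S ⧸ N) = 0`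
  (`Ideal.iInf_pow_smul_eq_bot_of_isLocalRing`), i.e. `f = q ^ 2 + i` with `i ∈ I`.
-/

open IsLocalRing

set_option linter.dupNamespace false

namespace Summit.ResolutionOfSingularities.ResolutionOfSingularities.Theorems.SwitchingDichotomy

namespace SqModSq

variable {S T : Type} [CommRing S] [CommRing T]

/-! ## Contraction for `𝔪`-primary ideals -/

/-- **Contraction**: with `ι(S)` dense in `T` and `𝔪_T ^ N ∩ S = 𝔪 ^ N`, an `𝔪`-primary ideal `J ⊇ 𝔪 ^ N` satisfies `(J·T) ∩ S = J`.
[folklore] -/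
theorem mem_of_map_mem [IsLocalRing S] [IsLocalRing T] (ι : S →+* T)
    (hdense : ∀ (n : ℕ) (t : T), ∃ a : S, t - ι a ∈ maximalIdeal T ^ n)
    (hcontr : ∀ (n : ℕ) (a : S), ι a ∈ maximalIdeal T ^ n → a ∈ maximalIdeal S ^ n)
    {J : Ideal S} {N : ℕ} (hJ : maximalIdeal S ^ N ≤ J) {a : S} (ha : ι a ∈ J.map ι) : a ∈ J := by
  -- every element of `J.map ι` is `ι b + e` with `b ∈ J` and `e ∈ 𝔪_T ^ N`
  have key : ∀ x ∈ J.map ι, ∃ b ∈ J, x - ι b ∈ maximalIdeal T ^ N := by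
    intro x hx
    have hx' : x ∈ Submodule.span T (ι '' (J : Set S)) := hx
    refine Submodule.span_induction ?_ ?_ ?_ ?_ hx'
    · rintro _ ⟨b, hb, rfl⟩
      exact ⟨b, hb, by rw [sub_self]; exact zero_mem _⟩
    · exact ⟨0, J.zero_mem, by rw [map_zero, sub_zero]; exact zero_mem _⟩
    · rintro x y - - ⟨b, hb, hxb⟩ ⟨c, hc, hyc⟩
      refine ⟨b + c, J.add_mem hb hc, ?_⟩
      have : x + y - ι (b + c) = (x - ι b) + (y - ι c) := by rw [map_add]; ring
      rw [this]
      exact add_mem hxb hyc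
    · rintro t x - ⟨b, hb, hxb⟩
      obtain ⟨s, hs⟩ := hdense N t
      refine ⟨s * b, J.mul_mem_left s hb, ?_⟩
      have : t • x - ι (s * b) = (t - ι s) * x + ι s * (x - ι b) := by rw [smul_eq_mul, map_mul]; ring
      rw [this]
      exact add_mem (Ideal.mul_mem_right _ _ hs) (Ideal.mul_mem_left _ _ hxb)
  obtain ⟨b, hb, hab⟩ := key _ ha
  rw [← map_sub] at hab
  have h := J.add_mem (hJ (hcontr N _ hab)) hb
  rwa [sub_add_cancel] at h

/-! ## The `𝔪`-primary ideals of squares -/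

/-- The ideal `sqIdeal n` generated by the squares of the elements of `𝔪 ^ n` is `𝔪`-primary. [folklore] -/
theorem exists_pow_le_sqIdeal [IsLocalRing S] [IsNoetherianRing S] (n : ℕ) :
    ∃ N : ℕ, maximalIdeal S ^ N ≤ Ideal.span ((fun m : S => m ^ 2) '' ((maximalIdeal S ^ n : Ideal S) : Set S)) := by
  refine Ideal.exists_pow_le_of_le_radical_of_fg (fun m hm => ⟨2 * n, ?_⟩) (IsNoetherian.noetherian _)
  rw [mul_comm, pow_mul]
  exact Ideal.subset_span ⟨m ^ n, Ideal.pow_mem_pow hm n, rfl⟩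

/-- In characteristic `2`, the square of an element of `𝔪_T ^ n = (𝔪 ^ n)·T` lies in `(sqIdeal n)·T`. [folklore] -/
theorem sq_mem_map_sqIdeal [IsLocalRing S] [IsLocalRing T] (ι : S →+* T) (h2 : (2 : T) = 0)
    (hmap : (maximalIdeal S).map ι = maximalIdeal T) (n : ℕ) {e : T} (he : e ∈ maximalIdeal T ^ n) :
    e ^ 2 ∈ (Ideal.span ((fun m : S => m ^ 2) '' ((maximalIdeal S ^ n : Ideal S) : Set S))).map ι := by
  rw [← hmap, ← Ideal.map_pow] at he
  have he' : e ∈ Submodule.span T (ι '' ((maximalIdeal S ^ n : Ideal S) : Set S)) := he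
  refine Submodule.span_induction (p := fun (e : T) (_ : e ∈ Submodule.span T (ι '' ((maximalIdeal S ^ n : Ideal S) : Set S))) =>
    e ^ 2 ∈ (Ideal.span ((fun m : S => m ^ 2) '' ((maximalIdeal S ^ n : Ideal S) : Set S))).map ι) ?_ ?_ ?_ ?_ he'
  · rintro _ ⟨m, hm, rfl⟩
    rw [← map_pow]
    exact Ideal.mem_map_of_mem _ (Ideal.subset_span ⟨m, hm, rfl⟩)
  · rw [zero_pow two_ne_zero]
    exact zero_mem _
  · intro x y _ _ hx hy
    rw [add_sq, h2, zero_mul, zero_mul, add_zero]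
    exact add_mem hx hy
  · intro t x _ hx
    rw [smul_eq_mul, mul_pow]
    exact Ideal.mul_mem_left _ _ hx

/-! ## Approximation -/

/-- `T` has characteristic `2` along with `S`. [folklore] -/
theorem two_eq_zero_of_ringHom [CharP S 2] (ι : S →+* T) : (2 : T) = 0 := by
  have h := congrArg ι (CharTwo.two_eq_zero (R := S))
  rwa [map_ofNat, map_zero] at h

/-- **Approximation**: if `ι f + q̂ ^ 2 ∈ I·T`, then for every `n` there is `a ∈ S` with `f + a ^ 2 ∈ I ⊔ sqIdeal n`
(`q̂ = ι a + e`, `e ∈ 𝔪_T ^ n`, and `ι (f + a ^ 2) = (ι f + q̂ ^ 2) + e ^ 2` in characteristic `2`). [folklore] -/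
theorem exists_sq_add_mem_sup [IsLocalRing S] [IsNoetherianRing S] [CharP S 2] [IsLocalRing T] (ι : S →+* T)
    (hmap : (maximalIdeal S).map ι = maximalIdeal T)
    (hdense : ∀ (n : ℕ) (t : T), ∃ a : S, t - ι a ∈ maximalIdeal T ^ n)
    (hcontr : ∀ (n : ℕ) (a : S), ι a ∈ maximalIdeal T ^ n → a ∈ maximalIdeal S ^ n)
    (I : Ideal S) (f : S) (h : ∃ q : T, ι f + q ^ 2 ∈ I.map ι) (n : ℕ) :
    ∃ a : S, f + a ^ 2 ∈ I ⊔ Ideal.span ((fun m : S => m ^ 2) '' ((maximalIdeal S ^ n : Ideal S) : Set S)) := by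
  obtain ⟨q, hq⟩ := h
  obtain ⟨a, ha⟩ := hdense n q
  obtain ⟨N, hN⟩ := exists_pow_le_sqIdeal (S := S) n
  have h2 := two_eq_zero_of_ringHom ι
  refine ⟨a, mem_of_map_mem ι hdense hcontr (hN.trans le_sup_right) ?_⟩
  have key : ι (f + a ^ 2) = (ι f + q ^ 2) + (q - ι a) ^ 2 := by
    rw [map_add, map_pow]
    linear_combination (q * ι a - q ^ 2) * h2
  rw [key, Ideal.map_sup]
  exact add_mem (Ideal.mem_sup_left hq) (Ideal.mem_sup_right (sq_mem_map_sqIdeal ι h2 hmap n ha))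

/-! ## Krull intersection in the Frobenius module -/

/-- **Krull step**: if `S` is an F-finite Noetherian local ring of characteristic `2` and `f + a_n ^ 2 ∈ I ⊔ sqIdeal n` for every `n`
(with `a_n` depending on `n`), then `f + q ^ 2 ∈ I` for one `q ∈ S`. [folklore] -/
theorem sq_add_mem_of_forall [IsLocalRing S] [IsNoetherianRing S] [CharP S 2]
    (hF : Module.Finite (frobenius S 2).range S) (I : Ideal S) (f : S)
    (h : ∀ n : ℕ, ∃ a : S, f + a ^ 2 ∈ I ⊔ Ideal.span ((fun m : S => m ^ 2) '' ((maximalIdeal S ^ n : Ideal S) : Set S))) :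
    ∃ q : S, f + q ^ 2 ∈ I := by
  set A : Subring S := (frobenius S 2).range with hA
  haveI : IsLocalRing A :=
    IsLocalRing.of_surjective' (frobenius S 2).rangeRestrict (frobenius S 2).rangeRestrict_surjective
  haveI : Module.Finite A S := hF
  have h2S : (2 : S) = 0 := CharTwo.two_eq_zero
  -- the square `m ^ 2` of `m ∈ 𝔪 ^ n`, as an element of `A`, lies in `𝔪_A ^ n`
  have hφ : (maximalIdeal S).map (frobenius S 2).rangeRestrict ≤ maximalIdeal A := by
    rw [Ideal.map_le_iff_le_comap]
    intro m hm
    rw [Ideal.mem_comap]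
    intro hu
    apply hm
    have hu' : IsUnit (((frobenius S 2).rangeRestrict m : A) : S) := hu.map A.subtype
    rw [RingHom.coe_rangeRestrict, frobenius_def] at hu'
    exact (isUnit_pow_iff two_ne_zero).mp hu'
  have hfrob : ∀ (n : ℕ) (m : S) (hm : m ∈ maximalIdeal S ^ n),
      (frobenius S 2).rangeRestrict m ∈ maximalIdeal A ^ n := by
    intro n m hm
    have h1 := Ideal.mem_map_of_mem (frobenius S 2).rangeRestrict hm
    rw [Ideal.map_pow] at h1
    exact Ideal.pow_right_mono hφ n h1
  -- `sqIdeal n ≤ 𝔫 ^ n • S`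
  have hmul : ∀ (n : ℕ) (s j : S), j ∈ (maximalIdeal A ^ n • ⊤ : Submodule A S) →
      s * j ∈ (maximalIdeal A ^ n • ⊤ : Submodule A S) := by
    intro n s j hj
    refine Submodule.smul_induction_on hj (fun a ha x _ => ?_) (fun x y hx hy => ?_)
    · have : s * (a • x) = a • (s * x) := by rw [Algebra.smul_def, Algebra.smul_def]; ring
      rw [this]
      exact Submodule.smul_mem_smul ha Submodule.mem_top
    · rw [mul_add]
      exact add_mem hx hy
  have hJ : ∀ (n : ℕ), ∀ j ∈ Ideal.span ((fun m : S => m ^ 2) '' ((maximalIdeal S ^ n : Ideal S) : Set S)),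
      j ∈ (maximalIdeal A ^ n • ⊤ : Submodule A S) := by
    intro n j hj
    refine Submodule.span_induction ?_ ?_ ?_ ?_ hj
    · rintro _ ⟨m, hm, rfl⟩
      have : m ^ 2 = ((frobenius S 2).rangeRestrict m : A) • (1 : S) := by
        rw [Algebra.smul_def, mul_one]
        rfl
      show m ^ 2 ∈ _
      rw [this]
      exact Submodule.smul_mem_smul (hfrob n m hm) Submodule.mem_top
    · exact zero_mem _
    · intro x y _ _ hx hy
      exact add_mem hx hy
    · intro s x _ hx
      rw [smul_eq_mul]
      exact hmul n s x hx
  -- the `A`-submodule `N = A·1 + I` and the class of `f` in `S ⧸ N`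
  let N : Submodule A S := Submodule.span A {1} ⊔ I.restrictScalars A
  have hf : ∀ n : ℕ, N.mkQ f ∈ (maximalIdeal A ^ n • ⊤ : Submodule A (S ⧸ N)) := by
    intro n
    obtain ⟨a, ha⟩ := h n
    obtain ⟨i, hi, j, hj, hij⟩ := Submodule.mem_sup.mp ha
    have hsq : a ^ 2 ∈ Submodule.span A ({1} : Set S) := by
      have : a ^ 2 = ((frobenius S 2).rangeRestrict a : A) • (1 : S) := by
        rw [Algebra.smul_def, mul_one]
        rfl
      rw [this]
      exact Submodule.smul_mem _ _ (Submodule.mem_span_singleton_self 1)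
    have hfj : N.mkQ f = N.mkQ j := by
      rw [Submodule.mkQ_apply, Submodule.mkQ_apply, Submodule.Quotient.eq]
      have : f - j = a ^ 2 + i := by linear_combination -hij - a ^ 2 * h2S
      rw [this]
      exact add_mem (Submodule.mem_sup_left hsq) (Submodule.mem_sup_right hi)
    rw [hfj]
    have h1 := Submodule.mem_map_of_mem (f := N.mkQ) (hJ n j hj)
    rw [Submodule.map_smul''] at h1
    exact Submodule.smul_mono le_rfl le_top h1
  have hbot := (maximalIdeal A).iInf_pow_smul_eq_bot_of_isLocalRing (M := S ⧸ N)
    (maximalIdeal.isMaximal A).ne_top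
  have hf0 : N.mkQ f = 0 := by
    have h1 : N.mkQ f ∈ (⨅ i : ℕ, maximalIdeal A ^ i • ⊤ : Submodule A (S ⧸ N)) := (Submodule.mem_iInf _).mpr hf
    rwa [hbot, Submodule.mem_bot] at h1
  have hfN : f ∈ N := by
    rw [Submodule.mkQ_apply, Submodule.Quotient.mk_eq_zero] at hf0
    exact hf0
  obtain ⟨x, hx, i, hi, hxi⟩ := Submodule.mem_sup.mp hfN
  obtain ⟨c, rfl⟩ := Submodule.mem_span_singleton.mp hx
  obtain ⟨q, hq⟩ := RingHom.mem_range.mp c.2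
  refine ⟨q, ?_⟩
  have hfq : f + q ^ 2 = i := by
    rw [← hxi, Algebra.smul_def, mul_one, ← frobenius_def, hq]
    change (c : S) + i + (c : S) = i
    linear_combination (c : S) * h2S
  rw [hfq]
  exact hi

/-! ## K-β6 -/

/-- **K-β6 `SqModSqDescent`.**  Let `S` be an F-finite Noetherian local ring of characteristic `2` and `ι : S →+* T` a map to a local
ring with `𝔪_S·T = 𝔪_T`, `ι(S)` dense and `𝔪_T ^ n ∩ S = 𝔪 ^ n` (e.g. `T = Ŝ` the `𝔪`-adic completion).  For every ideal `I` of `S` and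
`f ∈ S`: if `ι f + q̂ ^ 2 ∈ I·T` for some `q̂ ∈ T`, then `f + q ^ 2 ∈ I` for some `q ∈ S`.  (Applied with `I = 𝔭 ^ 2`, `𝔭` an
r.s.o.p.-part prime, this is the words' `SqModSqDescent`.) [folklore] -/
theorem sq_add_mem_of_hat [IsLocalRing S] [IsNoetherianRing S] [CharP S 2] [IsLocalRing T] (ι : S →+* T)
    (hmap : (maximalIdeal S).map ι = maximalIdeal T)
    (hdense : ∀ (n : ℕ) (t : T), ∃ a : S, t - ι a ∈ maximalIdeal T ^ n)
    (hcontr : ∀ (n : ℕ) (a : S), ι a ∈ maximalIdeal T ^ n → a ∈ maximalIdeal S ^ n)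
    (hF : Module.Finite (frobenius S 2).range S)
    (I : Ideal S) (f : S) (h : ∃ q : T, ι f + q ^ 2 ∈ I.map ι) : ∃ q : S, f + q ^ 2 ∈ I :=
  sq_add_mem_of_forall hF I f (exists_sq_add_mem_sup ι hmap hdense hcontr I f h)

/-- **K-β6 in the words' shape** (v18 `SqModSqDescent`, binders `IsRegularLocalRing S` / `IsExcellentRing S` / `IsRsopPart ![u₁, u₂, u₃]` not
needed and therefore absent; `IsHatOf ι` entered through its three clauses; F-finiteness added): a square class modulo `𝔭 ^ 2`,
`𝔭 = (u₁, u₂, u₃)`, represented by a square in `T` is represented by a square in `S`. [folklore] -/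
theorem sqModSqDescent (S T : Type) [CommRing S] [IsLocalRing S] [CharP S 2] [CommRing T] [IsLocalRing T]
    (ι : S →+* T) (u₁ u₂ u₃ f : S) (hS : IsNoetherianRing S)
    (hmap : (maximalIdeal S).map ι = maximalIdeal T)
    (hdense : ∀ (n : ℕ) (t : T), ∃ a : S, t - ι a ∈ maximalIdeal T ^ n)
    (hcontr : ∀ (n : ℕ) (a : S), ι a ∈ maximalIdeal T ^ n → a ∈ maximalIdeal S ^ n)
    (hF : Module.Finite (frobenius S 2).range S)
    (h : ∃ q : T, ι f + q ^ 2 ∈ (Ideal.span {u₁, u₂, u₃} ^ 2).map ι) :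
    ∃ q : S, f + q ^ 2 ∈ Ideal.span {u₁, u₂, u₃} ^ 2 :=
  haveI := hS
  sq_add_mem_of_hat ι hmap hdense hcontr hF _ f h

end SqModSq

end Summit.ResolutionOfSingularities.ResolutionOfSingularities.Theorems.SwitchingDichotomy
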